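import Literature.MathematicalPhysics.KineticTheory.HardSphereUniformGas
import Literature.Analysis.FluidPDE.HardSphereFlowJointMeasurable
import Summits.AtomisticToContinuum.HydrodynamicLimit.Theorems.BandCoherenceLDAlongFamilies.Negative.Pathwise
import HarnessLib

/-!
# Band-coherence drift witness: one-body velocity marginal and measurability of the band functional

Helper theorems for the refutation of the crux `OneFlightGossipEngine.BandCoherenceLDAlongFamilies`
(stmt-AtomisticToContinuum-17700) by the Galilean-boost / entropy-inequality argument under the
homogeneous local Gibbs law `G_N(a, u, θ) = localGibbsLaw σ a u θ N Φ` (constant profiles).  No Theses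
declaration is asserted positively in this file (pure helper theorems, no definitions).

* `map_vel_localGibbsLaw_const` — the law of the velocity of particle `i` under `G_N(a, u, θ)` is the
  Maxwellian `N(u, θ id) = gaussMeasure u θ` (rung-0 product structure
  `localGibbsMeasure_rung0_eq_map`: positions and velocities are independent, the velocities i.i.d.;
  then the `i`-th marginal of a product of probability measures).
* `aestronglyMeasurable_intervalIntegral_comp_flow_vec` — `ℝ³`-valued window integrals
  `z ↦ ∫_a^b F(Φ_s z) ds` of a measurable observable along a hard-sphere flow on `𝕋³` are a.e.-strongly
  measurable for every law carried by the good set (the vector-valued twin of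
  `HardSphereFlow.aemeasurable_intervalIntegral_comp_flow_torus`: joint measurability of the flow on
  the good set and Fubini measurability).
* `aemeasurable_bandFunctional` — the band-coherence functional
  `S = Σᵢ 1{η cubᵢ < ‖q̄ᵢ‖} cubBandᵢ` of the crux (window means of `‖vᵢ − c‖³`, of
  `R(‖vᵢ − c‖²)(vᵢ − c)` with the witness weight `R(s′) = (s′ − k²)1{k² < s′ ≤ K²}`, and of the band cube
  `1{k < ‖vᵢ − c‖ ≤ K}‖vᵢ − c‖³`) is a.e.-measurable for every law carried by the good set.

References: H. Spohn, *Large Scale Dynamics of Interacting Particles* (1991), Part I §2.3 (product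
structure of local equilibrium states); Fubini measurability is folklore
(C. Cercignani, R. Illner, M. Pulvirenti, *The Mathematical Theory of Dilute Gases* (1994), App. 4.A).
-/

noncomputable section

open MeasureTheory ProbabilityTheory Set Filter Topology
open scoped ENNReal

namespace Summit.AtomisticToContinuum.HydrodynamicLimit.Theorems

namespace BandCoherenceLDRefutation

open Literature.MathematicalPhysics.KineticTheory Literature.Analysis.FluidPDE

/-! ## One-body velocity marginal of the homogeneous local Gibbs law -/

/-- **One-body velocity marginal of the homogeneous local Gibbs law**: for constant profiles
`a, θ > 0`, `u` and `σ ≤ 1/2`, the law of the velocity of particle `i` under `G_N(a, u, θ)` is the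
Maxwellian `N(u, θ id)`.  By the rung-0 product structure `G_N = zipConfig_# (posGibbs ⊗ ⊗ᵢ N(u, θ id))`
(Spohn 1991, Part I §2.3) the velocity of particle `i` is `eval i ∘ Prod.snd` of a pair whose first
factor is a probability measure, so its law is the `i`-th marginal of the product `⊗ᵢ N(u, θ id)`. [folklore] -/
theorem map_vel_localGibbsLaw_const {σ a θ : ℝ} (hσ2 : σ ≤ 1 / 2) (ha : 0 < a) (hθ : 0 < θ) (u : V3) (N : ℕ)
    (Φ : HardSphereFlow (Torus.geometry (Fin 3)) (hsDiameter σ N) (N + 1)) (i : Fin (N + 1)) :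
    (localGibbsLaw σ (fun _ => a) (fun _ => u) (fun _ => θ) N Φ).map (fun z => (z i).2) = gaussMeasure u θ := by
  haveI := isProbabilityMeasure_posGibbsMeasure (a₀ := fun _ : T3 => a) continuous_const (fun _ => ha) hσ2 N
  have hcomp : (fun z : Config (N + 1) (Fin 3) T3 => (z i).2) ∘
      (zipConfig : (Fin (N + 1) → T3) × (Fin (N + 1) → V3) → Config (N + 1) (Fin 3) T3) =
      Function.eval i ∘ Prod.snd := by
    funext p
    rfl
  rw [localGibbsLaw_eq, localGibbsMeasure_rung0_eq_map σ ha.le hθ u N,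
    Measure.map_map (measurable_pi_apply i).snd measurable_zipConfig, hcomp,
    ← Measure.map_map (measurable_pi_apply i) measurable_snd, Measure.map_snd_prod, measure_univ,
    one_smul]
  exact (measurePreserving_eval (fun _ : Fin (N + 1) => gaussMeasure u θ) i).map_eq

/-! ## Measurability of vector-valued window integrals and of the band functional -/

/-- **Vector-valued window integrals along the flow are a.e.-strongly measurable**: for a measurable
observable `F : Config → ℝ³` on the phase space of `N` hard spheres in `𝕋³`, every window `a..b` and
every measure `μ` carried by the good set (`μ Φ.goodᶜ = 0`), `z ↦ ∫_a^b F(Φ_s z) ds` is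
`μ`-a.e. strongly measurable (on the good set it is strongly measurable by the joint measurability of
the flow and Fubini, `HardSphereFlow.stronglyMeasurable_integral_comp_flow`, written as the difference
of the integrals over `Ioc a b` and `Ioc b a`; the good set is conull). [folklore] -/
theorem aestronglyMeasurable_intervalIntegral_comp_flow_vec {N : ℕ} {ε : ℝ}
    (Φ : HardSphereFlow (Torus.geometry (Fin 3)) ε N) {F : Config N (Fin 3) T3 → V3} (hF : Measurable F)
    (a b : ℝ) {μ : Measure (Config N (Fin 3) T3)} (hμ : μ Φ.goodᶜ = 0) :
    AEStronglyMeasurable (fun z => ∫ s in a..b, F (Φ.flow s z)) μ := by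
  have hG : ∀ x : T3, Continuous ((Torus.geometry (Fin 3)).translate x) := fun x =>
    (continuous_const.add Literature.Analysis.FunctionSpaces.Torus.continuous_proj :
      Continuous fun v : V3 => x + Literature.Analysis.FunctionSpaces.Torus.proj v)
  refine (Φ.aemeasurable_of_measurable_comp_subtype ?_ hμ).aestronglyMeasurable
  have h1 := (Φ.stronglyMeasurable_integral_comp_flow hG hF.stronglyMeasurable
    (volume.restrict (Ioc a b))).measurable
  have h2 := (Φ.stronglyMeasurable_integral_comp_flow hG hF.stronglyMeasurable
    (volume.restrict (Ioc b a))).measurable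
  simp only [intervalIntegral]
  exact h1.sub h2

/-- **The band-coherence functional is a.e.-measurable** under every law carried by the good set:
for a hard-sphere flow on `𝕋³`, a window `w`, cut-offs `k, K`, a threshold `η` and a centring `c`,
`z ↦ Σᵢ 1{η cubᵢ(z) < ‖q̄ᵢ(z)‖} cubBandᵢ(z)` — with the window means
`cubᵢ = w⁻¹∫₀ʷ ‖vᵢ(r) − c‖³ dr`, `q̄ᵢ = w⁻¹∫₀ʷ R(‖vᵢ(r) − c‖²)(vᵢ(r) − c) dr`
(`R(s′) = (s′ − k²)1{k² < s′ ≤ K²}`) and `cubBandᵢ = w⁻¹∫₀ʷ 1{k < ‖vᵢ(r) − c‖ ≤ K}‖vᵢ(r) − c‖³ dr`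
along the orbit — is `μ`-a.e. measurable whenever `μ Φ.goodᶜ = 0`.  Each window mean is a.e.-measurable
(real ones by `HardSphereFlow.aemeasurable_intervalIntegral_comp_flow_torus`, the `ℝ³`-valued one by
`aestronglyMeasurable_intervalIntegral_comp_flow_vec`), and the summand is the Borel function
`(x, y, t) ↦ 1{ηx < y} t` of the triple `(cubᵢ, ‖q̄ᵢ‖, cubBandᵢ)`. [folklore] -/
theorem aemeasurable_bandFunctional {N : ℕ} {ε : ℝ} (Φ : HardSphereFlow (Torus.geometry (Fin 3)) ε N)
    {μ : Measure (Config N (Fin 3) T3)} (hμ : μ Φ.goodᶜ = 0) (w k K η : ℝ) (c : V3) :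
    AEMeasurable (fun z => ∑ i : Fin N,
        (if η * (w⁻¹ * ∫ r in (0:ℝ)..w, ‖(Φ.flow r z i).2 - c‖ ^ 3) <
            ‖w⁻¹ • ∫ r in (0:ℝ)..w, (if k ^ 2 < ‖(Φ.flow r z i).2 - c‖ ^ 2 ∧ ‖(Φ.flow r z i).2 - c‖ ^ 2 ≤ K ^ 2
                then ‖(Φ.flow r z i).2 - c‖ ^ 2 - k ^ 2 else 0) • ((Φ.flow r z i).2 - c)‖
          then w⁻¹ * ∫ r in (0:ℝ)..w,
            (if k < ‖(Φ.flow r z i).2 - c‖ ∧ ‖(Φ.flow r z i).2 - c‖ ≤ K then ‖(Φ.flow r z i).2 - c‖ ^ 3 else 0)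
          else 0)) μ := by
  -- the Borel function `(x, y, t) ↦ 1{η x < y} t` of the three window means
  have hg : Measurable (fun p : ℝ × ℝ × ℝ => if η * p.1 < p.2.1 then p.2.2 else 0) :=
    Measurable.ite (measurableSet_lt (measurable_fst.const_mul η) (measurable_snd.fst))
      measurable_snd.snd measurable_const
  refine Finset.aemeasurable_fun_sum _ fun i _ => ?_
  -- the one-body observables entering the three window means are Borel
  have hvel : Measurable (fun y : Config N (Fin 3) T3 => (y i).2 - c) :=
    (measurable_pi_apply i).snd.sub_const c
  have hnorm : Measurable (fun y : Config N (Fin 3) T3 => ‖(y i).2 - c‖) := hvel.norm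
  have hcub : Measurable (fun y : Config N (Fin 3) T3 => ‖(y i).2 - c‖ ^ 3) := hnorm.pow_const 3
  have hR : Measurable (fun y : Config N (Fin 3) T3 =>
      (if k ^ 2 < ‖(y i).2 - c‖ ^ 2 ∧ ‖(y i).2 - c‖ ^ 2 ≤ K ^ 2 then ‖(y i).2 - c‖ ^ 2 - k ^ 2 else 0) •
        ((y i).2 - c)) :=
    ((BandCoherenceLDNegative.measurable_Rrad k K).comp (hnorm.pow_const 2)).smul hvel
  have hband : Measurable (fun y : Config N (Fin 3) T3 =>
      if k < ‖(y i).2 - c‖ ∧ ‖(y i).2 - c‖ ≤ K then ‖(y i).2 - c‖ ^ 3 else 0) :=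
    Measurable.ite ((measurableSet_lt measurable_const hnorm).inter (measurableSet_le hnorm measurable_const))
      hcub measurable_const
  -- the three window means are a.e.-measurable
  have h1 : AEMeasurable (fun z => w⁻¹ * ∫ r in (0:ℝ)..w, ‖(Φ.flow r z i).2 - c‖ ^ 3) μ :=
    (Φ.aemeasurable_intervalIntegral_comp_flow_torus hcub 0 w hμ).const_mul w⁻¹
  have h2 : AEMeasurable (fun z => ‖w⁻¹ • ∫ r in (0:ℝ)..w,
      (if k ^ 2 < ‖(Φ.flow r z i).2 - c‖ ^ 2 ∧ ‖(Φ.flow r z i).2 - c‖ ^ 2 ≤ K ^ 2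
        then ‖(Φ.flow r z i).2 - c‖ ^ 2 - k ^ 2 else 0) • ((Φ.flow r z i).2 - c)‖) μ :=
    ((aestronglyMeasurable_intervalIntegral_comp_flow_vec Φ hR 0 w hμ).aemeasurable.const_smul w⁻¹).norm
  have h3 : AEMeasurable (fun z => w⁻¹ * ∫ r in (0:ℝ)..w,
      (if k < ‖(Φ.flow r z i).2 - c‖ ∧ ‖(Φ.flow r z i).2 - c‖ ≤ K then ‖(Φ.flow r z i).2 - c‖ ^ 3 else 0)) μ :=
    (Φ.aemeasurable_intervalIntegral_comp_flow_torus hband 0 w hμ).const_mul w⁻¹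
  exact hg.comp_aemeasurable (h1.prodMk (h2.prodMk h3))

end BandCoherenceLDRefutation

end Summit.AtomisticToContinuum.HydrodynamicLimit.Theorems

end
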